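import Mathlib
import Summits.ValiantsHypothesis.ValiantsHypothesis.Theorems.MatrixDescartes.Negative.MatrixDescartesWitness24

/-!
# `MatrixDescartes` — census vocabulary: the row predicate `RealRootLawAt`

HONEST FRAMING.  Definitions-only companion of the census frame for the crux
`Summit.ValiantsHypothesis.ValiantsHypothesis.Theses.LacunarySymmetroid.MatrixDescartes` (ledger item
`stmt-ValiantsHypothesis-18050`, route `LacunarySymmetroid`; object-search cell `pub-symmetroid`).  Nothing is
proved or claimed here; in particular nothing about the crux or about `VP ≠ VNP`.

The crux counts, for a `K`-term real symmetric `m × m` LACUNARY PENCIL `F = ∑ l, X ^ (d l) • S l`, the number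
`Z(d, S) = (det F).roots.toFinset.card` of distinct real zeros of its determinant, and asserts
`Z ^ q ≤ 2 ^ (K ⌊log₂ K⌋)` eventually in `K`, uniformly for `m ≤ 2 ^ ((⌊log₂ K⌋ + c) ^ c)`.  The census of
the cell tabulates, per format `(m, K)`, the maximum `M(m, K)` of `Z` over all such pencils.  The one notion
this needs beyond Mathlib is the ROW PREDICATE `RealRootLawAt m K B` ("`M(m, K) ≤ B`"), written with the
crux's expression verbatim so that rows compose with the crux by `Iff.rfl`-level unfolding (see the frame
file `LacunarySymmetroidMatrixDescartesCensusFrame.lean`: `matrixDescartes_iff_realRootLaw`, known rows,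
certificate lemmas).  Its positive-zeros twin `PosRootLawAt` already lives in
`Theorems/MatrixDescartes/Negative/MatrixDescartesWitness24.lean`.

Design choices: the bound `B` is a free natural-number parameter (rows are inequalities `M(m,K) ≤ B`, refuted
rows are `¬ RealRootLawAt m K B`), so no `sSup`/junk value is needed for `M(m, K)` itself; symmetry of every
coefficient is part of the row, exactly as in the crux; the zero polynomial has no counted roots (Mathlib's
`Polynomial.roots 0 = 0`), as in the crux.
-/

-- `Summit.ValiantsHypothesis.ValiantsHypothesis.…` repeats a component by the D-0017 layout
-- (single-conjunct summit), which the `dupNamespace` linter flags; the name is mandated.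
set_option linter.dupNamespace false

namespace Summit.ValiantsHypothesis.ValiantsHypothesis.Theorems.LacunarySymmetroidMatrixDescartes

/-- **Census row predicate (all real zeros).**  `RealRootLawAt m K B`: for every exponent vector
`d : Fin K → ℕ` and all real symmetric `m × m` matrices `S l` (`l < K`), the determinant of the lacunary
pencil `∑ l, X ^ (d l) • S l` has at most `B` distinct real zeros — in the notation of the cell's census,
`M(m, K) ≤ B`.  The counted quantity is literally the one of the crux `MatrixDescartes`
(`(Matrix.det _).roots.toFinset.card`; the zero polynomial has no roots). [folklore] -/
def RealRootLawAt (m K B : ℕ) : Prop :=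
  ∀ (d : Fin K → ℕ) (S : Fin K → Matrix (Fin m) (Fin m) ℝ), (∀ l, (S l).IsSymm) →
    (Matrix.det (∑ l, ((Polynomial.X : Polynomial ℝ) ^ d l) • (S l).map Polynomial.C)
      ).roots.toFinset.card ≤ B

/-- **The cell's CONJECTURE B — the «`K + log² m` law»** (object-search cell `pub-symmetroid`, theory seat,
`HOME/CONJECTURE.md` v1.1 §3, 2026-08-22; a CONJECTURE of the cell, stated here as a named `Prop`, never asserted;
NOT a published result).  Text as printed: "There is an absolute constant `C` such that for all `m, K ≥ 2`, all
exponents and all real symmetric (equivalently, by the doubling, all real) pencils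
`log₂ ζ_tot(m,K) ≤ C · (K + log₂² m)`."  Typed in census currency (`ζ_tot(m,K) ≤ B` is the row
`RealRootLawAt m K B`; `log₂` of a natural number read as `Nat.log 2`, the crux's own convention): some `C : ℕ`
makes every format `(m, K)` satisfy the row with bound `2 ^ (C * (K + (Nat.log 2 m) ^ 2))`.  The printed side
conditions `m, K ≥ 2` are dropped harmlessly: for `K ≤ 1` the count is `≤ 1` (`OneTermSector`), and for `m ≤ 1`
it is `≤ 2K − 1 ≤ 2 ^ (2K)` (Descartes), so any `C ≥ 2` absorbs them.  The theory seat proves on paper, and the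
companion bridge file proves in the kernel, `KPlusLogSqLaw → MatrixDescartes` (in the crux's regime
`m ≤ 2^((log₂K+c)^c)` the bound is `2^(O_c(K))`, and `O(K) = o(K log K)`); the converse is not claimed.
[conjecture of the cell; no citation exists] -/
def KPlusLogSqLaw : Prop :=
  ∃ C : ℕ, ∀ m K : ℕ, RealRootLawAt m K (2 ^ (C * (K + Nat.log 2 m ^ 2)))

open Summit.ValiantsHypothesis.ValiantsHypothesis.Theorems.MatrixDescartes.Negative (PosRootLawAt) in
/-- **The cell's CONJECTURE A3 — «the `K = 3` column is Descartes-extremal»** (object-search cell `pub-symmetroid`,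
theory seat, `HOME/CONJECTURE.md` §3 (A3), all versions v1–v1.5 FINAL, 2026-08-22; typed at the lead's request R28;
a CONJECTURE of the cell stated as a named `Prop`, never asserted; NOT a published result).  Text as printed:
"(A3) `ζ(m,3) = C(m+2,2) − 1` for all `m` (square column; §2.2)", where `ζ(m,K)` is the maximal number of distinct
positive real zeros of `det (∑ l, X^(d l) • S l)` over all `K`-term real symmetric `m × m` lacunary pencils and
`C(m+2,2) − 1 = D(m,3)` is the Descartes ceiling of the format.  Typed in `ζ`-currency with the tree's row predicate
`PosRootLawAt m K B` («`ζ(m,K) ≤ B`», file `Theorems/MatrixDescartes/Negative/MatrixDescartesWitness24.lean`): for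
every `m ≥ 1` the row with bound `C(m+2,2) − 1` holds and the row with bound `C(m+2,2) − 2` fails.  The first
conjunct is a theorem for every `m` (Descartes: `Census.posRootLawAt_descartes m 3`), so the content is the second
(`Census.kThreeColumnLaw_iff`, companion file); `m = 0` is excluded since `ζ(0,K) = 0`.  Status 2026-08-22:
verified in the kernel for `1 ≤ m ≤ 6` (`Census.a3_column_le_six`: `ζ = 2, 5, 9, 14, 20, 27`), a candidate exact
row `(7,3) = 35` exists (lead R27); heuristic support: real symmetric determinantal representations of real plane
curves (Helton–Vinnikov), `CONJECTURE.md` §2.2.  In all-real-zeros currency the statement reads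
`M(m,3) = 2·C(m+2,2) − 1` (`Census.posRootLawAt_iff_realRootLawAt`). [conjecture of the cell; no citation exists] -/
def KThreeColumnLaw : Prop :=
  ∀ m : ℕ, 1 ≤ m →
    PosRootLawAt m 3 (Nat.choose (m + 2) 2 - 1) ∧ ¬ PosRootLawAt m 3 (Nat.choose (m + 2) 2 - 2)

open Summit.ValiantsHypothesis.ValiantsHypothesis.Theorems.MatrixDescartes.Negative (PosRootLawAt) in
/-- **The cell's CONJECTURE (T), thin scope — «every THIN format is Descartes-extremal»** (object-search cell
`pub-symmetroid`, `HOME/STRUCTURE.md` §2.2 as RE-SCOPED by the lead's ruling R45, 2026-08-22T22:02Z, after the fork theorem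
`Census.not_matrixDescartes_of_formatExtremal`; a CONJECTURE of the cell stated as a named `Prop`, never asserted; NOT a published
result).  Text as ruled: "for every THIN format, `min(m,K) ≤ 3` (the `K ≤ 3` column for all `m`, the `m = 2` ladder and the `m = 3`
flags for all `K`): `ζ_sym(m,K) = D(m,K) = C(m+K−1,m) − 1`".  Typed in `ζ`-currency, two-sided like `KThreeColumnLaw`: for all
`m ≥ 1`, `K ≥ 2` with `min m K ≤ 3`, the row with bound `C(m+K−1,m) − 1` holds (Descartes — a theorem for every format,
`Census.posRootLawAt_descartes`) and the row with bound `C(m+K−1,m) − 2` fails (the content).  `K = 1` is excluded (`ζ(m,1) = 0 = D`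
trivially, `OneTermSector`).  Kernel status 2026-08-22: proved for `K = 2` (all `m`, `Census.row_two`), `m = 1` (all `K`, `Census.row_one`),
`K = 3` with `m ≤ 7` (`Census.a3_column_le_seven`), `(2,4)` and `(2,5)` (`Census.posRootLaw_two_four_sharp`, `Census.row_2_5`); OPEN:
`K = 3, m ≥ 8`; `m = 2, K ≥ 6`; `m = 3, K ≥ 4` (kernel lower bounds `(2,6) ≥ 18`, `(2,7) ≥ 21`, `(3,4) ≥ 18 = D − 1`, …).  The companion
link file `…CensusThinLaw.lean` reduces it to exactly these open parts. [conjecture of the cell; no citation exists] -/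
def DescartesExtremalThin : Prop :=
  ∀ m K : ℕ, 1 ≤ m → 2 ≤ K → min m K ≤ 3 →
    PosRootLawAt m K (Nat.choose (m + K - 1) m - 1) ∧ ¬ PosRootLawAt m K (Nat.choose (m + K - 1) m - 2)

open Summit.ValiantsHypothesis.ValiantsHypothesis.Theorems.MatrixDescartes.Negative (PosRootLawAt) in
/-- **Format-level Descartes-extremality for ALL formats — the hypothesis of the fork theorem** (lead R45: typed for
bookkeeping, explicitly NOT conjectured by the cell; it REFUTES the crux `MatrixDescartes` by
`Census.not_matrixDescartes_of_formatExtremal`, format `(K², K)`): for all `m, K ≥ 1`, `ζ_sym(m,K) = C(m+K−1,m) − 1`, two-sided.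
The finite census cannot distinguish it from `DescartesExtremalThin` (every DECIDED format has `min(m,K) ≤ 3` or is
`(m,K)` with a lower bound only). [bookkeeping statement of the cell; no citation exists] -/
def FormatExtremalAll : Prop :=
  ∀ m K : ℕ, 1 ≤ m → 1 ≤ K →
    PosRootLawAt m K (Nat.choose (m + K - 1) m - 1) ∧ ¬ PosRootLawAt m K (Nat.choose (m + K - 1) m - 2)

open Summit.ValiantsHypothesis.ValiantsHypothesis.Theorems.MatrixDescartes.Negative (PosRootLawAt) in
/-- **Support-level row predicate — the currency of the cell's upper-bound TABLE «`ζ(m,K; d) ≤ B`»** (object-search cell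
`pub-symmetroid`, DATA-CUT item (b), 2026-08-23; a bookkeeping definition, nothing asserted).  `PosRootLawOn m K B d` says
that ON THE FIXED EXPONENT VECTOR `d : Fin K → ℕ` every real symmetric `m × m` lacunary pencil `∑ l, X ^ (d l) • S l`
has at most `B` distinct positive real zeros of its determinant — the body of `PosRootLawAt m K B` with the exponent
quantifier pulled out, so that `PosRootLawAt m K B ↔ ∀ d, PosRootLawOn m K B d` holds by `Iff.rfl`
(`Census.posRootLawAt_iff_forall_on`, companion link file).  The cell's kernel support certificates
(`Census.posRoots_le_19_on_2_6_<d₀_…_d₅>`: sign-class C22 instances and T-NC certificates) are exactly statements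
`PosRootLawOn 2 6 19 ![d₀, …, d₅]`, unfolded. [folklore] -/
def PosRootLawOn (m K B : ℕ) (d : Fin K → ℕ) : Prop :=
  ∀ (S : Fin K → Matrix (Fin m) (Fin m) ℝ), (∀ l, (S l).IsSymm) →
    ((∑ l, (Polynomial.X : Polynomial ℝ) ^ d l • (S l).map Polynomial.C).det.roots.toFinset.filter
      (fun t => 0 < t)).card ≤ B

open Summit.ValiantsHypothesis.ValiantsHypothesis.Theorems.MatrixDescartes.Negative (PosRootLawAt) in
/-- **DOOR A — the cell's standalone theorem TARGET at the K1 format `(2,6)`** (object-search cell `pub-symmetroid`, K1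
sprint; named by the lead g5 in `HOME/K1-PENCILTRANSFER-ANSWER.md` §3 on the coordinator's ask, 2026-08-23; a TARGET
statement typed as a named `Prop`, never asserted here; NOT a published result).  `DoorA26` says `ζ_sym(2,6) ≤ 19 =
D(2,6) − 1`: EVERY `6`-term real symmetric `2 × 2` lacunary pencil has at most `19` distinct positive real zeros of
its determinant — one less than the Descartes ceiling `C(7,2) − 1 = 20` (`Census.posRootLawAt_descartes 2 6`).
Unfolded (`Census.doorA26_iff`, `Iff.rfl`): `∀ (d : Fin 6 → ℕ) (S : Fin 6 → Matrix (Fin 2) (Fin 2) ℝ),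
(∀ l, (S l).IsSymm) → ((∑ l, X ^ d l • (S l).map C).det.roots.toFinset.filter (0 < ·)).card ≤ 19`.  The exponent
quantifier ranges over ALL `d`, as in the crux; the census normalisation `0 = d₀ < d₁ < ⋯ < d₅` is a theorem-level
reduction (companion files), not part of the statement.  KERNEL STATUS 2026-08-23: `18 ≤ ζ_sym(2,6) ≤ 20`
(`Census.k1_baseline`, `Census.bounds_2_6'`); `≤ 19` is PROVED support by support — on the record supports
`(0,9,11,12,17,N)`, `N ∈ {35,176,178,179,180,200,201}` (`Census.ub19_on_2_6_record_supports`, T-NC certificates) and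
on the sign-class supports `Census.posRoots_le_19_on_2_6_<d>` — and is OPEN as a format-level statement; its negation
is ONE pencil with `20` distinct positive roots (census maximum of record: `18`).  Meaning for the crux
(`K1-PENCILTRANSFER-ANSWER.md`): `DoorA26` would be the first FORMAT-LEVEL Descartes deficiency; it refutes
`FormatExtremalAll` and `DescartesExtremalThin` (link file) and implies NOTHING about `MatrixDescartes`, which the route's
deciding theorem consumes only at fat formats `m ≤ 2 ^ ((log₂ K + c) ^ c)`. [target statement of the cell; no citation exists] -/
def DoorA26 : Prop := PosRootLawAt 2 6 19

open Summit.ValiantsHypothesis.ValiantsHypothesis.Theorems.MatrixDescartes.Negative (PosRootLawAt) in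
/-- **DOOR A companion — the cell's theorem TARGET at the K1 format `(3,4)`** (same provenance as `DoorA26`; a TARGET
statement, never asserted; NOT a published result).  `DoorA34` says `ζ_sym(3,4) ≤ 18 = D(3,4) − 1`: every `4`-term
real symmetric `3 × 3` lacunary pencil has at most `18` distinct positive real zeros of its determinant, one less than
the Descartes ceiling `C(6,3) − 1 = 19`.  Unfolded (`Census.doorA34_iff`, `Iff.rfl`): `∀ (d : Fin 4 → ℕ)
(S : Fin 4 → Matrix (Fin 3) (Fin 3) ℝ), (∀ l, (S l).IsSymm) → ((∑ l, X ^ d l • (S l).map C).det.roots.toFinset.filter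
(0 < ·)).card ≤ 18`.  SYMMETRY IS LOAD-BEARING: general (non-symmetric) real `3 × 3` four-term pencils DO attain `19`
(`Census.G3K4E1.card_posRoots_eq`).  KERNEL STATUS 2026-08-23: `18 ≤ ζ_sym(3,4) ≤ 19` (`Census.k1_baseline`,
`Census.bounds_3_4'`); `DoorA34` is OPEN as a format-level statement (census maximum of record: `18`); it refutes
`FormatExtremalAll` and `DescartesExtremalThin` (link file) and implies nothing about `MatrixDescartes`.
[target statement of the cell; no citation exists] -/
def DoorA34 : Prop := PosRootLawAt 3 4 18

end Summit.ValiantsHypothesis.ValiantsHypothesis.Theorems.LacunarySymmetroidMatrixDescartes
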